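import Mathlib
import HarnessLib
import Literature.MathematicalPhysics.KineticTheory.HardSphereEuler
import Literature.MathematicalPhysics.KineticTheory.BackwardCluster
import Literature.MathematicalPhysics.KineticTheory.HardSphereDisplacementPathLength
import Summits.AtomisticToContinuum.HydrodynamicLimit.Theorems.RelayRaceLocalityGibbsLightConeLinkCountBridge
import Summits.AtomisticToContinuum.HydrodynamicLimit.Theorems.RelayRaceLocalityGibbsLightConeStubLinkCountTail

/-!
# Glue `L` of the line `Sketch` for the crux `RelayRaceLocality.GibbsLightCone`
(stmt-AtomisticToContinuum-12501): the space-time necklace bound implies the link-count tail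

Helper file (`--supports stmt-AtomisticToContinuum-12501`). The registered stub
`stub_linkCountTail_of_spaceTimeNecklaceBound` (GLUE L, skeleton revision 8) is the deterministic /
combinatorial reduction of the LINK-COUNT TAIL (some simple collision chain into the tagged
particle over the window `[0, M τ_N]` has more than `λ M / σ³` links with probability `≤ C e^{-cM}`)
to the SPACE-TIME NECKLACE BOUND `X` (for an injective label sequence `q 0 … q n`, nondecreasing
checking times `T 1 ≤ … ≤ T n` in the window and a look-ahead `Δ ≤ ε_N/√θ`, the Gibbs
probability that every hop `m` finds `q m, q (m+1)` within `ε_N + ∫_{T(m+1)}^{T(m+1)+Δ} ‖v_{q m}‖ +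
∫ ‖v_{q (m+1)}‖` at time `T (m+1)` is `≤ (C₁ (ε_N + Λ√θΔ)³)ⁿ`), through the landed first-moment
bridge `linkCountTail_of_simpleChainCountBound` (`…LinkCountBridge.lean`):

* SLABBING (`exists_slabMap_necklace_of_chain`): on a good orbit, a chain with link times
  `T 1 ≤ … ≤ T n` in `[0, W]` is, at the slab times `⌊T (m+1)/Δ⌋ Δ`, a necklace of the window form
  of `X` (contact partners stay within `ε +` their two path lengths over the slab,
  `pairDist_le_diam_add_pathLength_of_contact`, `…StubLinkCountTail.lean`); the slab map
  `m ↦ ⌊T (m+1)/Δ⌋ ∈ {0, …, ⌊W/Δ⌋}` is monotone;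
* COUNTING (`card_filter_monotone_le_choose`): there are at most `C(m+n, n)` monotone maps
  `Fin n → Fin (m+1)` (sorted lists of length `n` inject into `Sym (Fin (m+1)) n`, stars and bars);
* ARITHMETIC (`choose_mul_pow_le_exp_mul_pow`): `C(m+n,n) xⁿ ≤ e^{2xm} (3/4)ⁿ` for `0 ≤ x ≤ 1/4`
  (one term of the binomial expansion of `(1+2x)^{m+n}`, `1 + 2x ≤ e^{2x}`);
* the glue itself: mesh `Δ = ε_N/(Λ√θ)` (so `ε_N + Λ√θΔ = 2ε_N`, `W/Δ = ΛM/σ³`), union over the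
  `(N+1)ⁿ` label sequences ending at `p` and the monotone slab maps, `(N+1) ε_N³ = σ³`
  (`succ_mul_hsDiameter_pow_three`), the bad set is null: `Σ_q G ≤ C(m+n,n) (8C₁σ³)ⁿ ≤
  e^{16 C₁ Λ M} (3/4)ⁿ` once `32 C₁ σ³ ≤ 1`, which is the first-moment hypothesis of the bridge with
  `C₀ = 1`, `c₁ = 16 C₁ Λ`, `ρ = 3/4` (here `C₁` stands for `|C₁| + 1`).

The necklace bound `X` itself is NOT proved here: it is the hypothesis of the glue (the open seam
of the line).
-/

namespace Summit.AtomisticToContinuum.HydrodynamicLimit.Theorems.LogWindowTaggedTail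

open Literature.MathematicalPhysics.KineticTheory Literature.Analysis.FluidPDE MeasureTheory Filter Set

open scoped ENNReal

section Slabbing

variable {d : Type*} [Fintype d] {ε : ℝ} {N : ℕ}

/-- **Slabbing of a collision chain.** On a good orbit of a hard-sphere flow on `T^d`, let
`q 0, …, q n` carry a collision chain whose link `m` (contact of `{q m, q (m+1)}`) happens at time
`T (m+1)`, with `0 = T 0 ≤ T 1 ≤ … ≤ T n ≤ T (n+1) = W`, and let `Δ > 0` be a mesh. Then the slab
map `m ↦ ⌊T (m+1) / Δ⌋ ∈ {0, …, ⌊W/Δ⌋}` is monotone, the slab times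
`T' (m+1) = ⌊T (m+1)/Δ⌋ Δ` (with `T' 0 = 0`, `T' (n+1) = W`) are nondecreasing, and at the slab
time `T' (m+1)` the partners `q m, q (m+1)` are within `ε +` their two path lengths over the slab
`[T' (m+1), T' (m+1) + Δ]` (which contains the true link time). [folklore] -/
theorem exists_slabMap_necklace_of_chain (Φ : HardSphereFlow (Torus.geometry d) ε N)
    {z : Config N d (UnitAddTorus d)} (hz : z ∈ Φ.good) {Δ W : ℝ} (hΔ : 0 < Δ) {n : ℕ}
    (q : Fin (n + 1) → Fin N) (T : Fin (n + 2) → ℝ) (hT : Monotone T) (hT0 : T 0 = 0)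
    (hTW : T (Fin.last (n + 1)) = W)
    (hlink : ∀ m : Fin n, s(q (Fin.castSucc m), q (Fin.succ m)) ∈
      contactPairSet (Torus.geometry d) ε (Φ.flow (T (Fin.castSucc (Fin.succ m))) z)) :
    ∃ (s : Fin n → Fin (⌊W / Δ⌋₊ + 1)) (T' : Fin (n + 2) → ℝ), Monotone s ∧ Monotone T' ∧
      T' 0 = 0 ∧ T' (Fin.last (n + 1)) = W ∧
      (∀ m : Fin n, T' (Fin.castSucc (Fin.succ m)) = ((s m : ℕ) : ℝ) * Δ) ∧
      ∀ m : Fin n,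
        Torus.euclidDist ((Φ.flow (T' (Fin.castSucc (Fin.succ m))) z) (q (Fin.castSucc m))).1
            ((Φ.flow (T' (Fin.castSucc (Fin.succ m))) z) (q (Fin.succ m))).1 ≤
          ε +
            (∫ u in (T' (Fin.castSucc (Fin.succ m)))..(T' (Fin.castSucc (Fin.succ m)) + Δ),
              ‖((Φ.flow u z) (q (Fin.castSucc m))).2‖) +
            ∫ u in (T' (Fin.castSucc (Fin.succ m)))..(T' (Fin.castSucc (Fin.succ m)) + Δ),
              ‖((Φ.flow u z) (q (Fin.succ m))).2‖ := by
  have hT0' : ∀ j, 0 ≤ T j := fun j => hT0 ▸ hT (Fin.zero_le j)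
  have hTW' : ∀ j, T j ≤ W := fun j => hTW ▸ hT (Fin.le_last j)
  have hk : ∀ m : Fin n, ⌊T (Fin.castSucc (Fin.succ m)) / Δ⌋₊ ≤ ⌊W / Δ⌋₊ := fun m =>
    Nat.floor_le_floor (div_le_div_of_nonneg_right (hTW' _) hΔ.le)
  have hfl : ∀ j, ((⌊T j / Δ⌋₊ : ℕ) : ℝ) * Δ ≤ T j := fun j =>
    calc ((⌊T j / Δ⌋₊ : ℕ) : ℝ) * Δ ≤ T j / Δ * Δ :=
          mul_le_mul_of_nonneg_right (Nat.floor_le (div_nonneg (hT0' j) hΔ.le)) hΔ.le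
      _ = T j := div_mul_cancel₀ _ hΔ.ne'
  refine ⟨fun m => ⟨⌊T (Fin.castSucc (Fin.succ m)) / Δ⌋₊, Nat.lt_succ_of_le (hk m)⟩,
    fun j => if j = Fin.last (n + 1) then W else ((⌊T j / Δ⌋₊ : ℕ) : ℝ) * Δ,
    ?_, ?_, ?_, ?_, ?_, ?_⟩
  · intro i j hij
    simp only [Fin.mk_le_mk]
    refine Nat.floor_le_floor (div_le_div_of_nonneg_right (hT ?_) hΔ.le)
    exact Fin.castSucc_le_castSucc_iff.2 (Fin.succ_le_succ_iff.2 hij)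
  · intro i j hij
    by_cases hj : j = Fin.last (n + 1)
    · simp only [hj, if_true]
      by_cases hi : i = Fin.last (n + 1)
      · simp [hi]
      · rw [if_neg hi]
        exact (hfl i).trans (hTW' i)
    · have hi : i ≠ Fin.last (n + 1) := fun h => hj (Fin.last_le_iff.1 (h ▸ hij))
      dsimp only
      rw [if_neg hi, if_neg hj]
      exact mul_le_mul_of_nonneg_right
        (Nat.cast_le.2 (Nat.floor_le_floor (div_le_div_of_nonneg_right (hT hij) hΔ.le))) hΔ.le
  · have h0 : (0 : Fin (n + 2)) ≠ Fin.last (n + 1) := ne_of_lt Fin.last_pos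
    simp [h0, hT0]
  · simp
  · intro m
    simp
  · intro m
    have hne : Fin.castSucc (Fin.succ m) ≠ Fin.last (n + 1) := (Fin.castSucc_lt_last _).ne
    simp only [hne, if_false]
    have hb : T (Fin.castSucc (Fin.succ m)) ≤
        ((⌊T (Fin.castSucc (Fin.succ m)) / Δ⌋₊ : ℕ) : ℝ) * Δ + Δ := by
      have h1 := Nat.lt_floor_add_one (T (Fin.castSucc (Fin.succ m)) / Δ)
      have h2 : T (Fin.castSucc (Fin.succ m)) / Δ * Δ = T (Fin.castSucc (Fin.succ m)) :=
        div_mul_cancel₀ _ hΔ.ne'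
      nlinarith [mul_lt_mul_of_pos_right h1 hΔ]
    exact pairDist_le_diam_add_pathLength_of_contact Φ hz ⟨le_rfl, by linarith⟩ ⟨hfl _, hb⟩
      (hlink m)

end Slabbing

/-- **Counting monotone slab maps** (stars and bars): there are at most `C(m+n, n)` monotone maps
`Fin n → Fin (m+1)` — a monotone map is the sorted enumeration of its multiset of values, an
element of `Sym (Fin (m+1)) n`, whose cardinality is `C(m+1+n-1, n)` (`Sym.card_sym_eq_choose`).
[folklore] -/
theorem card_filter_monotone_le_choose (n m : ℕ) :
    ((Finset.univ : Finset (Fin n → Fin (m + 1))).filter Monotone).card ≤ (m + n).choose n := by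
  classical
  have h := Finset.card_le_card_of_injOn (s := (Finset.univ : Finset (Fin n → Fin (m + 1))).filter
      Monotone) (t := (Finset.univ : Finset (Sym (Fin (m + 1)) n)))
    (fun s => Sym.mk (↑(List.ofFn s)) (by simp)) (fun _ _ => Finset.mem_coe.2 (Finset.mem_univ _)) ?_
  · rw [Finset.card_univ, Sym.card_sym_eq_choose, Fintype.card_fin] at h
    have e : m + 1 + n - 1 = m + n := by omega
    rwa [e] at h
  · intro s₁ hs₁ s₂ hs₂ heq
    have h₁ : Monotone s₁ := (Finset.mem_filter.1 (Finset.mem_coe.1 hs₁)).2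
    have h₂ : Monotone s₂ := (Finset.mem_filter.1 (Finset.mem_coe.1 hs₂)).2
    have hval : ((List.ofFn s₁ : List (Fin (m + 1))) : Multiset (Fin (m + 1))) = List.ofFn s₂ :=
      congrArg Subtype.val heq
    have hperm : (List.ofFn s₁).Perm (List.ofFn s₂) := Multiset.coe_eq_coe.1 hval
    exact List.ofFn_injective (hperm.eq_of_sortedLE h₁.sortedLE_ofFn h₂.sortedLE_ofFn)

/-- One term of the binomial expansion: `C(m+n, n) yⁿ ≤ (1 + y)^{m+n}` for `y ≥ 0`. [folklore] -/
theorem choose_mul_pow_le_one_add_pow {y : ℝ} (hy : 0 ≤ y) (m n : ℕ) :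
    ((m + n).choose n : ℝ) * y ^ n ≤ (1 + y) ^ (m + n) := by
  rw [add_comm (1 : ℝ), add_pow]
  have hmem : n ∈ Finset.range (m + n + 1) := Finset.mem_range.2 (by omega)
  refine le_trans (le_of_eq ?_) (Finset.single_le_sum (fun k _ => by positivity) hmem)
  rw [one_pow, mul_one, mul_comm]

/-- **The arithmetic of the glue**: for `0 ≤ x ≤ 1/4`, `C(m+n, n) xⁿ ≤ e^{2xm} (3/4)ⁿ`
(`C(m+n,n) (2x)ⁿ ≤ (1+2x)^{m+n} = (1+2x)^m (1+2x)ⁿ`, `1 + 2x ≤ e^{2x}`, `(1+2x)/2 ≤ 3/4`).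
[folklore] -/
theorem choose_mul_pow_le_exp_mul_pow {x : ℝ} (hx0 : 0 ≤ x) (hx : x ≤ 1 / 4) (m n : ℕ) :
    ((m + n).choose n : ℝ) * x ^ n ≤ Real.exp (2 * x * m) * (3 / 4) ^ n := by
  have hbin := choose_mul_pow_le_one_add_pow (by linarith : (0 : ℝ) ≤ 2 * x) m n
  have h1 : (1 + 2 * x) ^ m ≤ Real.exp (2 * x * m) := by
    rw [show 2 * x * m = (m : ℝ) * (2 * x) by ring, Real.exp_nat_mul]
    exact pow_le_pow_left₀ (by linarith) (by linarith [Real.add_one_le_exp (2 * x)]) m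
  have h2 : ((1 + 2 * x) / 2) ^ n ≤ (3 / 4 : ℝ) ^ n :=
    pow_le_pow_left₀ (by linarith) (by linarith) n
  calc ((m + n).choose n : ℝ) * x ^ n = ((m + n).choose n : ℝ) * (2 * x) ^ n * (1 / 2) ^ n := by
        rw [mul_assoc, ← mul_pow, show 2 * x * (1 / 2) = x by ring]
    _ ≤ (1 + 2 * x) ^ (m + n) * (1 / 2) ^ n :=
        mul_le_mul_of_nonneg_right hbin (by positivity)
    _ = (1 + 2 * x) ^ m * ((1 + 2 * x) / 2) ^ n := by
        rw [pow_add, mul_assoc, ← mul_pow, show (1 + 2 * x) * (1 / 2) = (1 + 2 * x) / 2 by ring]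
    _ ≤ Real.exp (2 * x * m) * (3 / 4) ^ n :=
        mul_le_mul h1 h2 (by positivity) (Real.exp_pos _).le

/-- **GLUE L** (registered stub `stub_linkCountTail_of_spaceTimeNecklaceBound` of the line `Sketch`,
skeleton revision 8): the space-time necklace bound `X` implies the registered link-count tail.
Slabbing at mesh `Δ = ε_N/(Λ√θ)` (`exists_slabMap_necklace_of_chain`), union over the `(N+1)ⁿ` label
sequences ending at the tagged particle and the `≤ C(m+n, n)` monotone slab maps
(`card_filter_monotone_le_choose`, `m = ⌊ΛM/σ³⌋`), `(N+1) ε_N³ = σ³`, the null bad set, and the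
arithmetic `C(m+n,n) (8C₁σ³)ⁿ ≤ e^{16C₁ΛM} (3/4)ⁿ` for `32 C₁ σ³ ≤ 1`
(`choose_mul_pow_le_exp_mul_pow`) give the first-moment hypothesis of the landed bridge
`linkCountTail_of_simpleChainCountBound` with `C₀ = 1`, `c₁ = 16C₁Λ`, `ρ = 3/4`. [folklore] -/
theorem stub_linkCountTail_of_spaceTimeNecklaceBound :
    (∀ a θ : ℝ, 0 < a → 0 < θ → ∃ σ₀ : ℝ, 0 < σ₀ ∧ ∃ C₁ Λ : ℝ, 1 ≤ Λ ∧ ∀ K : ℝ, 0 < K →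
        ∀ σ : ℝ, 0 < σ → σ < σ₀ →
        ∀ Φ : (N : ℕ) → HardSphereFlow (Torus.geometry (Fin 3)) (hsDiameter σ N) (N + 1),
        ∀ᶠ N : ℕ in atTop, ∀ M : ℝ, 1 ≤ M → M ≤ K * Real.log ((N : ℝ) + 2) →
          ∀ Δ : ℝ, 0 < Δ → Δ ≤ hsDiameter σ N / Real.sqrt θ →
          ∀ (n : ℕ) (q : Fin (n + 1) → Fin (N + 1)) (T : Fin (n + 2) → ℝ),
            Function.Injective q → Monotone T → T 0 = 0 →
            T (Fin.last (n + 1)) = M * (((N + 1 : ℕ) : ℝ) ^ (-(1 / 3 : ℝ)) / σ ^ 2 / Real.sqrt θ) →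
          localGibbsLaw σ (fun _ => a) (fun _ => 0) (fun _ => θ) N (Φ N)
            {z | ∀ m : Fin n,
                Torus.euclidDist (((Φ N).flow (T (Fin.castSucc (Fin.succ m))) z) (q (Fin.castSucc m))).1
                    (((Φ N).flow (T (Fin.castSucc (Fin.succ m))) z) (q (Fin.succ m))).1 ≤
                  hsDiameter σ N +
                    (∫ u in (T (Fin.castSucc (Fin.succ m)))..(T (Fin.castSucc (Fin.succ m)) + Δ),
                      ‖(((Φ N).flow u z) (q (Fin.castSucc m))).2‖) +
                    ∫ u in (T (Fin.castSucc (Fin.succ m)))..(T (Fin.castSucc (Fin.succ m)) + Δ),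
                      ‖(((Φ N).flow u z) (q (Fin.succ m))).2‖}
            ≤ ENNReal.ofReal ((C₁ * (hsDiameter σ N + Λ * Real.sqrt θ * Δ) ^ 3) ^ n)) →
    ∀ a θ : ℝ, 0 < a → 0 < θ → ∃ σ₀ : ℝ, 0 < σ₀ ∧ ∃ lam c C : ℝ, 0 < c ∧ ∀ K : ℝ, 0 < K →
      ∀ σ : ℝ, 0 < σ → σ < σ₀ →
      ∀ Φ : (N : ℕ) → HardSphereFlow (Torus.geometry (Fin 3)) (hsDiameter σ N) (N + 1),
      ∀ᶠ N in atTop, ∀ p : Fin (N + 1), ∀ M : ℝ, 1 ≤ M → M ≤ K * Real.log ((N : ℝ) + 2) →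
        localGibbsLaw σ (fun _ => a) (fun _ => 0) (fun _ => θ) N (Φ N)
          {z | ∃ (k : ℕ) (q : Fin (k + 1) → Fin (N + 1)) (T : Fin (k + 2) → ℝ),
              q (Fin.last k) = p ∧ Function.Injective q ∧ Monotone T ∧
              StrictMono (fun m : Fin k => T (Fin.castSucc (Fin.succ m))) ∧ T 0 = 0 ∧
              T (Fin.last (k + 1)) = M * (((N + 1 : ℕ) : ℝ) ^ (-(1 / 3 : ℝ)) / σ ^ 2 / Real.sqrt θ) ∧
              (∀ m : Fin k, s(q (Fin.castSucc m), q (Fin.succ m)) ∈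
                contactPairSet (Torus.geometry (Fin 3)) (hsDiameter σ N)
                  ((Φ N).flow (T (Fin.castSucc (Fin.succ m))) z)) ∧
              lam * M * (((N + 1 : ℕ) : ℝ) ^ (-(1 / 3 : ℝ)) / σ ^ 2) < k * hsDiameter σ N}
          ≤ ENNReal.ofReal (C * Real.exp (-c * M)) := by
  intro hX
  refine linkCountTail_of_simpleChainCountBound fun a θ ha hθ => ?_
  obtain ⟨σ₁, hσ₁, C₁, Λ, hΛ, H⟩ := hX a θ ha hθ
  -- constants, all fixed before `σ`
  have hΛ0 : 0 < Λ := one_pos.trans_le hΛ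
  set C : ℝ := |C₁| + 1 with hC
  have hC0 : 0 < C := by positivity
  have hC1 : |C₁| ≤ C := by rw [hC]; linarith
  refine ⟨min σ₁ (min 1 (1 / (32 * C))), lt_min hσ₁ (lt_min one_pos (by positivity)), 1,
    16 * C * Λ, 3 / 4, by norm_num, by norm_num, ?_⟩
  intro K hK σ hσ hσlt Φ
  have hσσ₁ : σ < σ₁ := lt_of_lt_of_le hσlt (min_le_left _ _)
  have hσ1 : σ ≤ 1 := (lt_of_lt_of_le hσlt ((min_le_right _ _).trans (min_le_left _ _))).le
  have hσC : σ ≤ 1 / (32 * C) :=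
    (lt_of_lt_of_le hσlt ((min_le_right _ _).trans (min_le_right _ _))).le
  have hx : 8 * C * σ ^ 3 ≤ 1 / 4 := by
    have h3 : σ ^ 3 ≤ σ := pow_le_of_le_one hσ.le hσ1 (by norm_num)
    have h4 : σ * (32 * C) ≤ 1 := by rwa [le_div_iff₀ (by positivity)] at hσC
    nlinarith [mul_le_mul_of_nonneg_left h3 (by positivity : (0 : ℝ) ≤ 8 * C)]
  have hx0 : 0 ≤ 8 * C * σ ^ 3 := by positivity
  filter_upwards [H K hK σ hσ hσσ₁ Φ] with N hN p M hM hMK n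
  -- units: `ε = σ ν`, `W = M ν / (σ² √θ)`, mesh `Δ = ε / (Λ √θ)`, `m = ⌊W / Δ⌋ = ⌊Λ M / σ³⌋`
  have hε : 0 < hsDiameter σ N := hsDiameter_pos hσ N
  have hsq : 0 < Real.sqrt θ := Real.sqrt_pos.2 hθ
  have hM0 : 0 ≤ M := by linarith
  have hgood0 : localGibbsLaw σ (fun _ => a) (fun _ => 0) (fun _ => θ) N (Φ N) (Φ N).goodᶜ = 0 := by
    unfold localGibbsLaw particleLaw
    exact withDensity_absolutelyContinuous _ _ (Φ N).measure_compl_good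
  set ν : ℝ := ((N + 1 : ℕ) : ℝ) ^ (-(1 / 3 : ℝ)) with hν
  have hνpos : 0 < ν := Real.rpow_pos_of_pos (by positivity) _
  have hεν : hsDiameter σ N = σ * ν := rfl
  set W : ℝ := M * (ν / σ ^ 2 / Real.sqrt θ) with hW
  set Δ : ℝ := hsDiameter σ N / (Λ * Real.sqrt θ) with hΔdef
  have hΔ : 0 < Δ := div_pos hε (mul_pos hΛ0 hsq)
  have hΔle : Δ ≤ hsDiameter σ N / Real.sqrt θ := by
    rw [hΔdef, mul_comm, ← div_div]
    exact div_le_self (div_nonneg hε.le hsq.le) hΛ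
  have hΛΔ : Λ * Real.sqrt θ * Δ = hsDiameter σ N := by
    rw [hΔdef]
    field_simp
  have hWΔ : W / Δ = Λ * M / σ ^ 3 := by
    rw [hW, hΔdef, hεν]
    field_simp
  set m : ℕ := ⌊W / Δ⌋₊ with hm
  have hmle : (m : ℝ) ≤ Λ * M / σ ^ 3 := by
    rw [hm, ← hWΔ]
    exact Nat.floor_le (div_nonneg (by positivity) hΔ.le)
  set P := localGibbsLaw σ (fun _ => a) (fun _ => 0) (fun _ => θ) N (Φ N) with hP
  -- the real per-necklace bound `R = (C (2ε)³)ⁿ ≥ (C₁ (ε + Λ√θΔ)³)ⁿ`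
  set R : ℝ := (C * (2 * hsDiameter σ N) ^ 3) ^ n with hR
  have hXR : (C₁ * (hsDiameter σ N + Λ * Real.sqrt θ * Δ) ^ 3) ^ n ≤ R := by
    rw [hΛΔ, ← two_mul, hR]
    calc (C₁ * (2 * hsDiameter σ N) ^ 3) ^ n ≤ |(C₁ * (2 * hsDiameter σ N) ^ 3) ^ n| :=
          le_abs_self _
      _ = (|C₁| * (2 * hsDiameter σ N) ^ 3) ^ n := by
          rw [abs_pow, abs_mul, abs_of_nonneg (by positivity : (0 : ℝ) ≤ (2 * hsDiameter σ N) ^ 3)]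
      _ ≤ (C * (2 * hsDiameter σ N) ^ 3) ^ n :=
          pow_le_pow_left₀ (by positivity) (mul_le_mul_of_nonneg_right hC1 (by positivity)) n
  have hR0 : 0 ≤ R := by positivity
  -- the slab necklace events, indexed by the label sequence and the slab map
  obtain ⟨B, hB⟩ : ∃ B : (Fin (n + 1) → Fin (N + 1)) → (Fin n → Fin (m + 1)) →
      Set (Config (N + 1) (Fin 3) T3), ∀ q s, B q s =
        {z | ∃ T' : Fin (n + 2) → ℝ, Monotone T' ∧ T' 0 = 0 ∧ T' (Fin.last (n + 1)) = W ∧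
          (∀ m' : Fin n, T' (Fin.castSucc (Fin.succ m')) = ((s m' : ℕ) : ℝ) * Δ) ∧
          ∀ m' : Fin n,
            Torus.euclidDist
                (((Φ N).flow (T' (Fin.castSucc (Fin.succ m'))) z) (q (Fin.castSucc m'))).1
                (((Φ N).flow (T' (Fin.castSucc (Fin.succ m'))) z) (q (Fin.succ m'))).1 ≤
              hsDiameter σ N +
                (∫ u in (T' (Fin.castSucc (Fin.succ m')))..(T' (Fin.castSucc (Fin.succ m')) + Δ),
                  ‖(((Φ N).flow u z) (q (Fin.castSucc m'))).2‖) +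
                ∫ u in (T' (Fin.castSucc (Fin.succ m')))..(T' (Fin.castSucc (Fin.succ m')) + Δ),
                  ‖(((Φ N).flow u z) (q (Fin.succ m'))).2‖} := ⟨_, fun _ _ => rfl⟩
  -- `X` bounds each slab necklace event of an injective label sequence
  have hper : ∀ q : Fin (n + 1) → Fin (N + 1), Function.Injective q →
      ∀ s : Fin n → Fin (m + 1), P (B q s) ≤ ENNReal.ofReal R := by
    intro q hinj s
    by_cases hex : ∃ T' : Fin (n + 2) → ℝ, Monotone T' ∧ T' 0 = 0 ∧ T' (Fin.last (n + 1)) = W ∧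
        ∀ m' : Fin n, T' (Fin.castSucc (Fin.succ m')) = ((s m' : ℕ) : ℝ) * Δ
    · obtain ⟨T₀, hT₀m, hT₀0, hT₀W, hT₀s⟩ := hex
      refine (measure_mono ?_).trans
        ((hN M hM hMK Δ hΔ hΔle n q T₀ hinj hT₀m hT₀0 hT₀W).trans (ENNReal.ofReal_le_ofReal hXR))
      intro z hz
      rw [hB] at hz
      obtain ⟨T', -, -, -, hT's, hz⟩ := hz
      intro m'
      have h := hz m'
      rw [hT's m'] at h
      rw [hT₀s m']
      exact h
    · refine Eq.trans_le (measure_mono_null (fun z hz => ?_) measure_empty) zero_le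
      rw [hB] at hz
      obtain ⟨T', h1, h2, h3, h4, -⟩ := hz
      exact (hex ⟨T', h1, h2, h3, h4⟩).elim
  -- monotone slab maps and label sequences ending at `p`
  set S : Finset (Fin n → Fin (m + 1)) := Finset.univ.filter Monotone with hS
  have hScard : (S.card : ℝ≥0∞) ≤ (((m + n).choose n : ℕ) : ℝ≥0∞) := by
    exact_mod_cast card_filter_monotone_le_choose n m
  have hcardF : (Finset.univ.filter fun q : Fin (n + 1) → Fin (N + 1) => q (Fin.last n) = p).card ≤
      (N + 1) ^ n := by
    have h := Finset.card_le_card_of_injOn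
      (s := Finset.univ.filter fun q : Fin (n + 1) → Fin (N + 1) => q (Fin.last n) = p)
      (t := (Finset.univ : Finset (Fin n → Fin (N + 1)))) (fun q i => q (Fin.castSucc i))
      (fun _ _ => Finset.mem_coe.2 (Finset.mem_univ _)) ?_
    · rwa [Finset.card_univ, Fintype.card_fun, Fintype.card_fin, Fintype.card_fin] at h
    · intro q₁ hq₁ q₂ hq₂ h
      have h₁ : q₁ (Fin.last n) = p := (Finset.mem_filter.1 (Finset.mem_coe.1 hq₁)).2
      have h₂ : q₂ (Fin.last n) = p := (Finset.mem_filter.1 (Finset.mem_coe.1 hq₂)).2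
      funext j
      refine Fin.lastCases ?_ (fun i => ?_) j
      · rw [h₁, h₂]
      · exact congr_fun h i
  -- union bound over the label sequences ending at `p` …
  refine (Finset.sum_le_sum (g := fun q => if q (Fin.last n) = p then
    (((m + n).choose n : ℕ) : ℝ≥0∞) * ENNReal.ofReal R else 0) fun q _ => ?_).trans ?_
  · by_cases hqp : q (Fin.last n) = p
    · rw [if_pos hqp]
      by_cases hinj : Function.Injective q
      · -- … over the null bad set and the monotone slab maps
        refine (measure_mono (t := (Φ N).goodᶜ ∪ ⋃ s ∈ S, B q s) ?_).trans ?_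
        · intro z hz
          by_cases hzg : z ∈ (Φ N).good
          · obtain ⟨-, -, T, hTm, -, hT0, hTW, hlink⟩ := hz
            obtain ⟨s, T', hs, hT'm, hT'0, hT'W, hT's, hneck⟩ :=
              exists_slabMap_necklace_of_chain (Φ N) hzg hΔ q T hTm hT0 hTW hlink
            refine Or.inr (Set.mem_iUnion₂.2 ⟨s, Finset.mem_filter.2 ⟨Finset.mem_univ _, hs⟩, ?_⟩)
            rw [hB]
            exact ⟨T', hT'm, hT'0, hT'W, hT's, hneck⟩
          · exact Or.inl hzg
        · refine (measure_union_le _ _).trans ?_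
          rw [hgood0, zero_add]
          refine (measure_biUnion_finset_le S (B q)).trans ?_
          refine (Finset.sum_le_card_nsmul _ _ (ENNReal.ofReal R) fun s _ => hper q hinj s).trans ?_
          rw [nsmul_eq_mul]
          exact mul_le_mul_left hScard _
      · refine Eq.trans_le (measure_mono_null (fun z hz => ?_) measure_empty) zero_le
        exact (hinj hz.2.1).elim
    · rw [if_neg hqp]
      refine le_of_eq (measure_mono_null (fun z hz => ?_) measure_empty)
      exact (hqp hz.1).elim
  · -- the arithmetic
    rw [Finset.sum_ite, Finset.sum_const_zero, add_zero, Finset.sum_const, nsmul_eq_mul]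
    refine (mul_le_mul_left (show ((Finset.univ.filter fun q : Fin (n + 1) → Fin (N + 1) =>
      q (Fin.last n) = p).card : ℝ≥0∞) ≤ (((N + 1) ^ n : ℕ) : ℝ≥0∞) by exact_mod_cast hcardF)
      _).trans ?_
    have hconv : ENNReal.ofReal ((((N + 1) ^ n : ℕ) : ℝ) * ((((m + n).choose n : ℕ) : ℝ) * R)) =
        (((N + 1) ^ n : ℕ) : ℝ≥0∞) * ((((m + n).choose n : ℕ) : ℝ≥0∞) * ENNReal.ofReal R) := by
      rw [ENNReal.ofReal_mul (by positivity), ENNReal.ofReal_mul (by positivity),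
        ENNReal.ofReal_natCast, ENNReal.ofReal_natCast]
    rw [← hconv]
    refine ENNReal.ofReal_le_ofReal ?_
    have hσ3 : ((N + 1 : ℕ) : ℝ) * hsDiameter σ N ^ 3 = σ ^ 3 := succ_mul_hsDiameter_pow_three σ N
    have hNR : (((N + 1) ^ n : ℕ) : ℝ) * R = (8 * C * σ ^ 3) ^ n := by
      rw [hR, Nat.cast_pow, ← mul_pow, ← hσ3]
      ring
    have key := choose_mul_pow_le_exp_mul_pow hx0 hx m n
    have hexp : Real.exp (2 * (8 * C * σ ^ 3) * m) ≤ Real.exp (16 * C * Λ * M) := by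
      refine Real.exp_le_exp.2 ?_
      have h1 : σ ^ 3 * (m : ℝ) ≤ Λ * M := by
        calc σ ^ 3 * (m : ℝ) ≤ σ ^ 3 * (Λ * M / σ ^ 3) :=
              mul_le_mul_of_nonneg_left hmle (by positivity)
          _ = Λ * M := by field_simp
      nlinarith [h1, hC0]
    calc (((N + 1) ^ n : ℕ) : ℝ) * ((((m + n).choose n : ℕ) : ℝ) * R)
        = (((m + n).choose n : ℕ) : ℝ) * ((((N + 1) ^ n : ℕ) : ℝ) * R) := by ring
      _ = (((m + n).choose n : ℕ) : ℝ) * (8 * C * σ ^ 3) ^ n := by rw [hNR]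
      _ ≤ Real.exp (2 * (8 * C * σ ^ 3) * m) * (3 / 4) ^ n := key
      _ ≤ Real.exp (16 * C * Λ * M) * (3 / 4) ^ n :=
          mul_le_mul_of_nonneg_right hexp (by positivity)
      _ = 1 * Real.exp (16 * C * Λ * M) * (3 / 4) ^ n := by rw [one_mul]

end Summit.AtomisticToContinuum.HydrodynamicLimit.Theorems.LogWindowTaggedTail
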